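import Summits.Ventures.HSemireg.AdditiveCrossDecomposition
import Summits.Ventures.HSemireg.AdditiveFootprintCover
import Summits.Ventures.HSemireg.AdditiveFootprintIncidence
import HarnessLib

/-!
# Venture HSemireg — THEOREM H-FOOT assembled: additive ⇒ class-dead on every balanced linked rectangle (composition of k = 350 §3, 454, 478)

Cell pub-hsemireg, seat p2 gen 16, note `p2/wlaws/GLUING16-p2g16.md` §6.  This file only COMPOSES three leaves: the incidence steps
`AdditiveFootprintIncidence.footprint_family` (478) give the footprint family; the COVER LEMMA
`AdditiveFootprintCover.exists_row_add_col_of_cover` (454) turns it into a row + column decomposition of the weighting on the rectangle;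
`AdditiveCrossDecomposition.rect_class_dead` (350 §3) turns the decomposition into equal class sums when rows and columns are class-balanced.
TO BE FILED ONLY AFTER 350, 454 AND 478 HAVE LANDED AND ARE BUILT (it imports them); the body was farm-checked on 2026-08-25 against local
copies of the three leaves in one file (p2 g16 work/TestCompose.lean, rc 0 / 0 warnings) — re-check against the tree before proposing.
What the kernel certifies: the composition; hypotheses exactly as in `AdditiveFootprintIncidence` plus finiteness and class balance of the
rectangle's rows and columns.  What it does not: that a given support satisfies them.

HONEST FRAMING. Finite incidence bookkeeping over the integers; no variety, cycle, cohomology class or semiregularity map occurs; nothing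
here bears on HC ∕ HC_CM ∕ HC_AV.
-/

namespace Summit.Ventures.HSemireg
namespace AdditiveFootprintTheorem
open Finset

variable {P₁ P₂ L₁ L₂ S K : Type*} [DecidableEq K]

/-- **THEOREM H-FOOT (composition).**  Under the incidence hypotheses of `AdditiveFootprintIncidence.footprint_family` on a balanced
linked rectangle `D × C ⊆ T` of a layer, an ADDITIVE weighting is a row term plus a column term on the rectangle; hence, if every row and
every column of the rectangle is class-balanced, all class sums of the weighting over the rectangle agree («additive ⇒ class-dead»). -/
theorem hfoot_rect
    (T : L₁ → L₂ → Prop) (A : P₁ → Prop) (A' : P₂ → Prop) (on₁ : P₁ → L₁ → Prop) (on₂ : P₂ → L₂ → Prop)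
    (dir₁ : L₁ → Option S) (dir₂ : L₂ → Option S) (w : L₁ → L₂ → ℤ) (a : P₁ → ℤ) (a' : P₂ → ℤ)
    (D : L₁ → Prop) (C : L₂ → Prop) (sR : {r // D r} → S) (sC : {c // C c} → S)
    (meet₁ : ∀ x r σ, x ≠ r → dir₁ r = some σ → dir₁ x ≠ some σ → ∃ p, on₁ p x ∧ on₁ p r)
    (meet₂ : ∀ y c τ, y ≠ c → dir₂ c = some τ → dir₂ y ≠ some τ → ∃ q, on₂ q y ∧ on₂ q c)
    (par₁ : ∀ x r σ p, x ≠ r → dir₁ x = some σ → dir₁ r = some σ → on₁ p x → on₁ p r → False)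
    (par₂ : ∀ y c τ q, y ≠ c → dir₂ y = some τ → dir₂ c = some τ → on₂ q y → on₂ q c → False)
    (two₁ : ∀ p q r c x y u v, A p → A' q → T r c → T x y → T u v → x ≠ r →
      on₁ p r → on₂ q c → on₁ p x → on₂ q y → on₁ p u → on₂ q v → (u = r ∧ v = c) ∨ (u = x ∧ v = y))
    (partner : ∀ p q r c, A p → A' q → T r c → on₁ p r → on₂ q c →
      ∃ x y, T x y ∧ x ≠ r ∧ y ≠ c ∧ on₁ p x ∧ on₂ q y)
    (crossA : ∀ x x' y y' p q, T x y → T x' y' → x ≠ x' → y ≠ y' →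
      on₁ p x → on₁ p x' → on₂ q y → on₂ q y' → A p → A' q)
    (crossA' : ∀ x x' y y' p q, T x y → T x' y' → x ≠ x' → y ≠ y' →
      on₁ p x → on₁ p x' → on₂ q y → on₂ q y' → A' q → A p)
    (add : ∀ p q r c x y, A p → A' q → T r c → T x y → x ≠ r → y ≠ c →
      on₁ p r → on₂ q c → on₁ p x → on₂ q y → w r c + w x y = a p + a' q)
    (blocks : ∀ x y σ τ, T x y → dir₁ x = some σ → dir₂ y = some τ →
      ∃ (Ds : L₁ → Prop) (Cs : L₂ → Prop), Ds x ∧ Cs y ∧ (∀ x' y', Ds x' → Cs y' → T x' y') ∧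
        (∀ σ', ∃ x', Ds x' ∧ dir₁ x' = some σ') ∧ (∀ τ', ∃ y', Cs y' ∧ dir₂ y' = some τ'))
    (rect : ∀ r c, D r → C c → T r c) (hsR : ∀ r, dir₁ r.1 = some (sR r)) (hsC : ∀ c, dir₂ c.1 = some (sC c))
    (balR : ∀ σ, ∃ r, sR r = σ) (balC : ∀ τ, ∃ c, sC c = τ) (three : ∀ i j : S, ∃ k, k ≠ i ∧ k ≠ j)
    (footR : ∀ r, D r → ∃ p, on₁ p r ∧ A p) (footC : ∀ c, C c → ∃ q, on₂ q c ∧ A' q) :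
    ∃ f : {r // D r} → ℤ, ∃ g : {c // C c} → ℤ, ∀ r c, w r.1 c.1 = f r + g c := by
  obtain ⟨Φ, wit, cover, closure⟩ := AdditiveFootprintIncidence.footprint_family T A A' on₁ on₂ dir₁ dir₂ w a a' D C sR sC
    meet₁ meet₂ par₁ par₂ two₁ partner crossA crossA' add blocks rect hsR hsC balR balC three footR footC
  exact AdditiveFootprintCover.exists_row_add_col_of_cover sR sC (fun r c => w r.1 c.1) Φ wit cover closure three balR balC

/-- **COROLLARY (additive ⇒ class-dead on the rectangle).** With finite, class-balanced rows and columns, all class sums agree. -/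
theorem hfoot_rect_class_dead
    (T : L₁ → L₂ → Prop) (A : P₁ → Prop) (A' : P₂ → Prop) (on₁ : P₁ → L₁ → Prop) (on₂ : P₂ → L₂ → Prop)
    (dir₁ : L₁ → Option S) (dir₂ : L₂ → Option S) (w : L₁ → L₂ → ℤ) (a : P₁ → ℤ) (a' : P₂ → ℤ)
    (D : L₁ → Prop) (C : L₂ → Prop) [Fintype {r // D r}] [Fintype {c // C c}] (sR : {r // D r} → S) (sC : {c // C c} → S)
    (cls : {r // D r} → {c // C c} → K)
    (meet₁ : ∀ x r σ, x ≠ r → dir₁ r = some σ → dir₁ x ≠ some σ → ∃ p, on₁ p x ∧ on₁ p r)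
    (meet₂ : ∀ y c τ, y ≠ c → dir₂ c = some τ → dir₂ y ≠ some τ → ∃ q, on₂ q y ∧ on₂ q c)
    (par₁ : ∀ x r σ p, x ≠ r → dir₁ x = some σ → dir₁ r = some σ → on₁ p x → on₁ p r → False)
    (par₂ : ∀ y c τ q, y ≠ c → dir₂ y = some τ → dir₂ c = some τ → on₂ q y → on₂ q c → False)
    (two₁ : ∀ p q r c x y u v, A p → A' q → T r c → T x y → T u v → x ≠ r →
      on₁ p r → on₂ q c → on₁ p x → on₂ q y → on₁ p u → on₂ q v → (u = r ∧ v = c) ∨ (u = x ∧ v = y))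
    (partner : ∀ p q r c, A p → A' q → T r c → on₁ p r → on₂ q c →
      ∃ x y, T x y ∧ x ≠ r ∧ y ≠ c ∧ on₁ p x ∧ on₂ q y)
    (crossA : ∀ x x' y y' p q, T x y → T x' y' → x ≠ x' → y ≠ y' →
      on₁ p x → on₁ p x' → on₂ q y → on₂ q y' → A p → A' q)
    (crossA' : ∀ x x' y y' p q, T x y → T x' y' → x ≠ x' → y ≠ y' →
      on₁ p x → on₁ p x' → on₂ q y → on₂ q y' → A' q → A p)
    (add : ∀ p q r c x y, A p → A' q → T r c → T x y → x ≠ r → y ≠ c →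
      on₁ p r → on₂ q c → on₁ p x → on₂ q y → w r c + w x y = a p + a' q)
    (blocks : ∀ x y σ τ, T x y → dir₁ x = some σ → dir₂ y = some τ →
      ∃ (Ds : L₁ → Prop) (Cs : L₂ → Prop), Ds x ∧ Cs y ∧ (∀ x' y', Ds x' → Cs y' → T x' y') ∧
        (∀ σ', ∃ x', Ds x' ∧ dir₁ x' = some σ') ∧ (∀ τ', ∃ y', Cs y' ∧ dir₂ y' = some τ'))
    (rect : ∀ r c, D r → C c → T r c) (hsR : ∀ r, dir₁ r.1 = some (sR r)) (hsC : ∀ c, dir₂ c.1 = some (sC c))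
    (balR : ∀ σ, ∃ r, sR r = σ) (balC : ∀ τ, ∃ c, sC c = τ) (three : ∀ i j : S, ∃ k, k ≠ i ∧ k ≠ j)
    (footR : ∀ r, D r → ∃ p, on₁ p r ∧ A p) (footC : ∀ c, C c → ∃ q, on₂ q c ∧ A' q)
    (hrow : ∀ (r : {r // D r}) (k k' : K),
      (univ.filter fun c => cls r c = k).card = (univ.filter fun c => cls r c = k').card)
    (hcol : ∀ (c : {c // C c}) (k k' : K),
      (univ.filter fun r => cls r c = k).card = (univ.filter fun r => cls r c = k').card)
    (k k' : K) :
    ∑ p ∈ univ.filter (fun p : {r // D r} × {c // C c} => cls p.1 p.2 = k), w p.1.1 p.2.1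
      = ∑ p ∈ univ.filter (fun p : {r // D r} × {c // C c} => cls p.1 p.2 = k'), w p.1.1 p.2.1 := by
  obtain ⟨f, g, hdec⟩ := hfoot_rect T A A' on₁ on₂ dir₁ dir₂ w a a' D C sR sC meet₁ meet₂ par₁ par₂ two₁ partner crossA crossA'
    add blocks rect hsR hsC balR balC three footR footC
  exact AdditiveCrossDecomposition.rect_class_dead cls (fun r c => w r.1 c.1) f g hdec hrow hcol k k'

end AdditiveFootprintTheorem
end Summit.Ventures.HSemireg
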